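import Summits.AtomisticToContinuum.Crystallization.Theorems.ReggeStarCoercivityDefectFreeCrystallizesPalmDefs

/-!
# Part 1 of the proof of `stub_goodLaw : GoodLawOfZeroDefects` (P1 of line `palm-good-law`, crux stmt-AtomisticToContinuum-13603): matching calculus and the finite-`N` geometric lemma

See the module docstring of the final part `ReggeStarCoercivityDefectFreeCrystallizesGoodLaw.lean` for
the overview. This part is pure finite geometry:

* `etaMatched_of_bijOn`, `exists_bijOn_of_etaMatched`, `etaMatched_image_of_injOn` — passing between
  `EtaMatched` (a bijection of subtypes) and bijections `Set.BijOn` of plain functions;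
* `exists_bijOn_of_good_matched` — a `Good` particle of a separated finite configuration whose
  recentred configuration is `(2, ε)`-matched both ways to a separated point set `S ∋ 0` forces the
  root `0` of `S` to be good at tolerance `1/20 + η` with the shell read in the open ball of radius
  `6/5 - η` (`ε ≤ η/4`, `η ≤ 1/50`, `2ε` below both separations).
-/

noncomputable section

open Filter Topology

namespace Summit.AtomisticToContinuum.Crystallization.Theorems.PalmGoodLaw

open Summit.AtomisticToContinuum.Crystallization.Theorems.DefectFreeCrystallizes.Negative.PredicateAPI
open Literature.MathematicalPhysics.StatisticalMechanics Literature.Geometry.DiscreteGeometry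

/-! ### `EtaMatched` versus `Set.BijOn` -/

/-- A bijection `g` between two finite point sets moving points by at most `η` witnesses
`EtaMatched η`. -/
theorem etaMatched_of_bijOn {η : ℝ} {T U : Finset (EuclideanSpace ℝ (Fin 3))}
    (g : EuclideanSpace ℝ (Fin 3) → EuclideanSpace ℝ (Fin 3))
    (hg : Set.BijOn g (↑T : Set (EuclideanSpace ℝ (Fin 3))) ↑U) (hd : ∀ t ∈ T, dist t (g t) ≤ η) :
    EtaMatched η T U :=
  ⟨hg.equiv g, fun t => hd t.1 t.2⟩

/-- From an `η`-matching of `T` with `U`, a bijection from `U` back onto `T` (as a plain function)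
moving points by at most `η`. -/
theorem exists_bijOn_of_etaMatched {η : ℝ} {T U : Finset (EuclideanSpace ℝ (Fin 3))}
    (h : EtaMatched η T U) :
    ∃ g : EuclideanSpace ℝ (Fin 3) → EuclideanSpace ℝ (Fin 3),
      Set.BijOn g (↑U : Set (EuclideanSpace ℝ (Fin 3))) ↑T ∧ ∀ u ∈ U, dist (g u) u ≤ η := by
  classical
  obtain ⟨e, he⟩ := h
  refine ⟨fun u => if hu : u ∈ U then ((e.symm ⟨u, hu⟩ : ↥T) : EuclideanSpace ℝ (Fin 3)) else u,
    ⟨?_, ?_, ?_⟩, ?_⟩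
  · intro u hu
    rw [Finset.mem_coe] at hu
    simp only [hu, dite_true]
    exact (e.symm ⟨u, hu⟩).2
  · intro u hu u' hu' huu'
    rw [Finset.mem_coe] at hu hu'
    simp only [hu, hu', dite_true] at huu'
    have := e.symm.injective (Subtype.ext huu')
    exact congrArg Subtype.val this
  · intro t ht
    rw [Finset.mem_coe] at ht
    refine ⟨(e ⟨t, ht⟩ : EuclideanSpace ℝ (Fin 3)), (e ⟨t, ht⟩).2, ?_⟩
    simp only [Finset.coe_mem, dite_true, Subtype.coe_eta, Equiv.symm_apply_apply]
  · intro u hu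
    simp only [hu, dite_true]
    have := he (e.symm ⟨u, hu⟩)
    rw [Equiv.apply_symm_apply] at this
    exact this

/-- Two parametrisations of finite point sets by the same finite index set, both injective and
pointwise within `η` of each other, give `η`-matched images. -/
theorem etaMatched_image_of_injOn {s : Finset (EuclideanSpace ℝ (Fin 3))}
    {φ ψ : EuclideanSpace ℝ (Fin 3) → EuclideanSpace ℝ (Fin 3)}
    (hφ : Set.InjOn φ (↑s : Set (EuclideanSpace ℝ (Fin 3)))) (hψ : Set.InjOn ψ ↑s) {η : ℝ}
    (hd : ∀ v ∈ s, dist (φ v) (ψ v) ≤ η) : EtaMatched η (s.image φ) (s.image ψ) := by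
  classical
  refine etaMatched_of_bijOn (ψ ∘ Function.invFunOn φ ↑s) ?_ ?_
  · rw [Finset.coe_image, Finset.coe_image]
    exact hψ.bijOn_image.comp (hφ.bijOn_image.symm hφ.bijOn_image.invOn_invFunOn.symm)
  · intro t ht
    obtain ⟨v, hv, rfl⟩ := Finset.mem_image.1 ht
    simp only [Function.comp_apply, hφ.leftInvOn_invFunOn hv]
    exact hd v hv

/-- Landing anchor of this file (registered stub of crux stmt-AtomisticToContinuum-13603; re-exports `exists_bijOn_of_etaMatched`). -/
theorem goodLaw_part01_anchor : ∀ (η : ℝ) (T U : Finset (EuclideanSpace ℝ (Fin 3))), Literature.Geometry.DiscreteGeometry.EtaMatched η T U → ∃ g : EuclideanSpace ℝ (Fin 3) → EuclideanSpace ℝ (Fin 3), Set.BijOn g (U : Set (EuclideanSpace ℝ (Fin 3))) (T : Set (EuclideanSpace ℝ (Fin 3))) ∧ ∀ u ∈ U, dist (g u) u ≤ η :=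
  fun _ _ _ h => exists_bijOn_of_etaMatched h

/-! ### The finite-`N` geometric lemma -/

/-- **A good particle matched to a separated rooted point set makes its root good (open cutoff,
enlarged tolerance).** Let `x` be a `δ₀`-separated configuration, `i` a particle whose rescaled
shell `shell x i a` is `1/20`-matched to `A(Pat)` for a pattern `Pat` of unit vectors and a scale
`a ∈ [9/10, 11/10]`, and let `S ∋ 0` be `δ`-separated and `(2, ε)`-matched both ways with the
recentred configuration `{x k - x i}`. If `0 ≤ ε ≤ η/4`, `η ≤ 1/50` and `2ε < δ₀, δ`, then the
points of `S ∖ {0}` in the OPEN ball of radius `6/5 - η` are in bijection with `Pat`, the point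
`f v` matched to `v` satisfying `dist (a⁻¹ • f v) (A v) ≤ 1/20 + η`. (Radial pinning puts the twelve
neighbours at norms `≤ 21a/20 ≤ 1.155 < 6/5 - η - ε`; separation makes the `ε`-matching a
bijection.) -/
theorem exists_bijOn_of_good_matched {N : ℕ} {x : Fin N → EuclideanSpace ℝ (Fin 3)} {i : Fin N}
    {δ₀ : ℝ} (hsep₀ : ∀ j k, j ≠ k → δ₀ ≤ dist (x j) (x k))
    {S : Set (EuclideanSpace ℝ (Fin 3))} (h0 : (0 : EuclideanSpace ℝ (Fin 3)) ∈ S) {δ : ℝ}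
    (hsep : ∀ p ∈ S, ∀ q ∈ S, p ≠ q → δ ≤ dist p q)
    {η ε : ℝ} (hε : 0 ≤ ε) (hεη : ε ≤ η / 4) (hη : η ≤ 1 / 50) (hεδ₀ : 2 * ε < δ₀)
    (hεδ : 2 * ε < δ)
    (hM1 : ∀ p ∈ S, ‖p‖ ≤ 2 → ∃ k, dist (x k - x i) p ≤ ε)
    (hM2 : ∀ k, ‖x k - x i‖ ≤ 2 → ∃ p ∈ S, dist (x k - x i) p ≤ ε)
    {a : ℝ} (ha₁ : 9 / 10 ≤ a) (ha₂ : a ≤ 11 / 10) {Pat : Finset (EuclideanSpace ℝ (Fin 3))}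
    (hPat : ∀ v ∈ Pat, ‖v‖ = 1) {A : EuclideanSpace ℝ (Fin 3) →ₗᵢ[ℝ] EuclideanSpace ℝ (Fin 3)}
    (hm : EtaMatched (1 / 20) (shell x i a) (Pat.image A)) :
    ∃ f : EuclideanSpace ℝ (Fin 3) → EuclideanSpace ℝ (Fin 3),
      Set.BijOn f ↑Pat {p : EuclideanSpace ℝ (Fin 3) | p ∈ S ∧ p ≠ 0 ∧ ‖p‖ < 6 / 5 - η} ∧
      ∀ v ∈ Pat, dist (a⁻¹ • f v) (A v) ≤ 1 / 20 + η := by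
  classical
  have ha : 0 < a := by linarith
  -- the reverse matching `gs : A(Pat) → shell x i a`, moving points by at most `1/20`
  obtain ⟨gs, hgs, hgsd⟩ := exists_bijOn_of_etaMatched hm
  -- radial pinning of the neighbours of `i`
  have hann : ∀ j ∈ nbrs x i, 19 / 20 * a ≤ ‖x j - x i‖ ∧ ‖x j - x i‖ ≤ 21 / 20 * a := by
    intro j hj
    have h := dist_sub_le_of_shellCloseTo ha hPat ⟨A, hm⟩ hj
    rw [dist_eq_norm, abs_le] at h
    constructor <;> linarith [h.1, h.2]
  -- a nearest configuration point of `S`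
  let pOf : EuclideanSpace ℝ (Fin 3) → EuclideanSpace ℝ (Fin 3) := fun q =>
    if h : ∃ p ∈ S, dist q p ≤ ε then h.choose else 0
  have hpOf : ∀ k, ‖x k - x i‖ ≤ 2 →
      pOf (x k - x i) ∈ S ∧ dist (x k - x i) (pOf (x k - x i)) ≤ ε := by
    intro k hk
    have h := hM2 k hk
    simp only [pOf, dif_pos h]
    exact h.choose_spec
  -- every pattern point `v` sits, through `gs`, over a neighbour displacement `x j - x i`
  have key : ∀ v ∈ Pat, ∃ j ∈ nbrs x i, a • gs (A v) = x j - x i ∧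
      pOf (x j - x i) ∈ S ∧ dist (x j - x i) (pOf (x j - x i)) ≤ ε ∧
      19 / 20 * a ≤ ‖x j - x i‖ ∧ ‖x j - x i‖ ≤ 21 / 20 * a := by
    intro v hv
    have hw : A v ∈ (↑(Pat.image A) : Set (EuclideanSpace ℝ (Fin 3))) :=
      Finset.mem_coe.2 (Finset.mem_image_of_mem A hv)
    have ht : gs (A v) ∈ shell x i a := hgs.mapsTo hw
    obtain ⟨j, hj, hjt⟩ := Finset.mem_image.1 ht
    have hq : a • gs (A v) = x j - x i := by rw [← hjt, smul_inv_smul₀ ha.ne']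
    have hn := hann j hj
    have h2 : ‖x j - x i‖ ≤ 2 := by linarith [hn.2]
    exact ⟨j, hj, hq, (hpOf j h2).1, (hpOf j h2).2, hn.1, hn.2⟩
  refine ⟨fun v => pOf (a • gs (A v)), ⟨?_, ?_, ?_⟩, ?_⟩
  · -- maps `Pat` into the punctured open ball of `S`
    intro v hv
    obtain ⟨j, -, hq, hpS, hpd, hlo, hhi⟩ := key v hv
    simp only [Set.mem_setOf_eq, hq]
    refine ⟨hpS, fun hp0 => ?_, ?_⟩
    · rw [hp0, dist_zero_right] at hpd
      linarith
    · have h1 := norm_sub_norm_le (pOf (x j - x i)) (x j - x i)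
      rw [dist_comm, dist_eq_norm] at hpd
      linarith
  · -- injective on `Pat`
    intro v hv v' hv' hvv'
    obtain ⟨j, -, hq, -, hpd, -, -⟩ := key v hv
    obtain ⟨j', -, hq', -, hpd', -, -⟩ := key v' hv'
    simp only [hq, hq'] at hvv'
    have hjj : j = j' := by
      by_contra hne
      have hfar := hsep₀ j j' hne
      have hclose : dist (x j - x i) (x j' - x i) ≤ 2 * ε := by
        calc dist (x j - x i) (x j' - x i)
            ≤ dist (x j - x i) (pOf (x j - x i)) + dist (pOf (x j - x i)) (x j' - x i) :=
              dist_triangle _ _ _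
          _ ≤ ε + ε := by
              refine add_le_add hpd ?_
              rw [hvv', dist_comm]
              exact hpd'
          _ = 2 * ε := by ring
      rw [dist_eq_norm, sub_sub_sub_cancel_right, ← dist_eq_norm] at hclose
      linarith
    subst hjj
    have h1 : gs (A v) = gs (A v') := smul_right_injective _ ha.ne' (hq.trans hq'.symm)
    have h2 : A v = A v' :=
      hgs.injOn (Finset.mem_coe.2 (Finset.mem_image_of_mem A hv))
        (Finset.mem_coe.2 (Finset.mem_image_of_mem A hv')) h1
    exact A.injective h2
  · -- onto the punctured open ball of `S`
    rintro p ⟨hpS, hp0, hpn⟩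
    have hη0 : 0 ≤ η := by linarith
    obtain ⟨k, hk⟩ := hM1 p hpS (by linarith)
    have hki : k ≠ i := by
      rintro rfl
      rw [sub_self, dist_comm, dist_zero_right] at hk
      have := hsep p hpS 0 h0 hp0
      rw [dist_zero_right] at this
      linarith
    have hqn : ‖x k - x i‖ ≤ ‖p‖ + ε := by
      have h1 := norm_sub_norm_le (x k - x i) p
      have hk' := hk
      rw [dist_eq_norm] at hk'
      linarith
    have hkn : k ∈ nbrs x i := by
      rw [mem_nbrs_iff, dist_comm, dist_eq_norm]
      exact ⟨hki, by linarith⟩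
    have ht : a⁻¹ • (x k - x i) ∈ shell x i a := Finset.mem_image.2 ⟨k, hkn, rfl⟩
    obtain ⟨w, hw, hwt⟩ := hgs.surjOn (Finset.mem_coe.2 ht)
    obtain ⟨v, hv, rfl⟩ := Finset.mem_image.1 (Finset.mem_coe.1 hw)
    refine ⟨v, Finset.mem_coe.2 hv, ?_⟩
    have hq : a • gs (A v) = x k - x i := by rw [hwt, smul_inv_smul₀ ha.ne']
    simp only [hq]
    obtain ⟨hpS', hpd'⟩ := hpOf k (by linarith)
    by_contra hne
    have hfar := hsep _ hpS' p hpS hne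
    have hclose : dist (pOf (x k - x i)) p ≤ 2 * ε := by
      calc dist (pOf (x k - x i)) p
          ≤ dist (pOf (x k - x i)) (x k - x i) + dist (x k - x i) p := dist_triangle _ _ _
        _ ≤ ε + ε := add_le_add (by rwa [dist_comm]) hk
        _ = 2 * ε := by ring
    linarith
  · -- displacement bound
    intro v hv
    obtain ⟨j, -, hq, -, hpd, -, -⟩ := key v hv
    have hgsv : gs (A v) = a⁻¹ • (x j - x i) := by rw [← hq, inv_smul_smul₀ ha.ne']
    have hd1 : dist (a⁻¹ • pOf (x j - x i)) (a⁻¹ • (x j - x i)) ≤ a⁻¹ * ε := by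
      rw [dist_smul₀, norm_inv, Real.norm_of_nonneg ha.le, dist_comm]
      exact mul_le_mul_of_nonneg_left hpd (inv_nonneg.2 ha.le)
    have hd2 : dist (a⁻¹ • (x j - x i)) (A v) ≤ 1 / 20 := by
      rw [← hgsv]
      exact hgsd (A v) (Finset.mem_image_of_mem A hv)
    have hd3 : a⁻¹ * ε ≤ η := by
      rw [inv_mul_le_iff₀ ha]
      nlinarith
    simp only [hq]
    calc dist (a⁻¹ • pOf (x j - x i)) (A v)
        ≤ dist (a⁻¹ • pOf (x j - x i)) (a⁻¹ • (x j - x i)) + dist (a⁻¹ • (x j - x i)) (A v) :=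
          dist_triangle _ _ _
      _ ≤ a⁻¹ * ε + 1 / 20 := add_le_add hd1 hd2
      _ ≤ 1 / 20 + η := by linarith

end Summit.AtomisticToContinuum.Crystallization.Theorems.PalmGoodLaw

end
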